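import Mathlib
import HarnessLib
import Summits.HubbardSuperconductivity.HubbardSuperconductivity.Theorems.KLProgrammeKLRegimeEngineFrameShiftDressingSupFlow
import Summits.HubbardSuperconductivity.HubbardSuperconductivity.Theorems.KLProgrammeKLRegimeEngineFrameShiftDressingFactorTablesG

/-!
# K3 gen-8-FLOW (stmt 20437 `KLRegimeEngineV17F2`, stub (C), «(C)-B-REP»/«(C)-B-ALIAS-L»): the corrected (B) door at the flow frames with the tree and
# dressing jets discharged from the GEVREY flow tables (v2) — every constant explicit, ratios free of the cutoff table's growth

Cell gate-hubbard-kl, seat p2 g14.  `…SupFlow._aliasing` (p581176) ∘ `…DressingFactorTablesG` (v2 tables: satisfiable `(Θ,Φ,Ξ)` envelopes under m-free table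
hypotheses; Gevrey-2 cutoff table; Gevrey factor jets `Literature.….HubbardUVSymbol{Resummed,Dressing}…Gevrey`).  Output
**`norm_iteratedFDeriv_klLocSelfEnergyRe_flowFrame_sub_le_aliasing_gevrey`**: the (B) door with `A = A′`, `A_J` closed terms growing like `((Md)!)²·ρ^{Md}·(2/N)^{Md−j−4}`
with `ρ` free of the cutoff table's growth — optimising `Md` gives the stretched-exponential volume decay and the threshold `L_alias` far below the registered door
`klEngL₄` (memo ALIAS-L-NUMBERS-p2g14.md, STATUS 2026-08-27 23:02Z).  Inputs: the door's own, the reading point below both shells, the flow history, the order-4 flat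
table `X₄`, the Gevrey table `(X₀, C_χ)` up to `Md`, the envelope parameters with `A_i ≤ i!Ξⁱ`, `A_i ≤ Gfr₀|U|Θ·i!·(2^{10}Φ)ⁱ`, `Gfr₀|U|Θ·16^{−m} ≤ Λ_m/4`, and the
two-leg moments.  Proofs only; no definitions; nothing asserts superconductivity.  References: BGM 2006 §2.3 (2.21)–(2.24), §3 (3.2)–(3.3)
[cite: BenfattoGiulianiMastropietro2006]; FST 1996 §1.
-/

noncomputable section

namespace Summit.HubbardSuperconductivity.HubbardSuperconductivity.Theorems.EngineV8

set_option linter.dupNamespace false -- summit = problem name (single-conjunct summit), D-0017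

open Real Finset Filter Literature.MathematicalPhysics.QuantumLattice Literature.Probability.LatticeModels GrassmannAlgebra
open Summit.HubbardSuperconductivity.HubbardSuperconductivity.Theorems.KLRegimeSplit
open Summit.HubbardSuperconductivity.HubbardSuperconductivity.Theorems.TwoVolumeDefect
open Summit.HubbardSuperconductivity.HubbardSuperconductivity.Theorems.KLProgrammeLegKernels
open Summit.HubbardSuperconductivity.HubbardSuperconductivity.Theorems.DispersionFlow
open scoped Nat

variable {L M : ℕ} [NeZero L] [NeZero M]

section Flow

variable {β : ℝ} (hβ : 0 < β) (U μ : ℝ) (m : ℕ)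
include hβ

/-- **THE CORRECTED (B) DOOR AT THE FLOW FRAMES, TREE AND DRESSING JETS DISCHARGED FROM THE GEVREY FLOW TABLES** (v2: satisfiable `(Θ,Φ,Ξ)`
envelopes, Gevrey-2 cutoff table `‖χ₂^{(l)}‖ ≤ X₀(l!)²C_χ^l`, every constant explicit, ratios free of the cutoff table's growth — the form in which the aliasing
threshold sits under the registered volume door, located risk «(C)-B-ALIAS-L»). [cite: BenfattoGiulianiMastropietro2006, §2.3 (2.21)–(2.24)] -/
theorem norm_iteratedFDeriv_klLocSelfEnergyRe_flowFrame_sub_le_aliasing_gevrey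
    {G : GeoConsts} {Q : EngConsts} {R : RenConsts} (hRG : ∀ j, 0 ≤ R.Gfr j) (hGS : ∀ k, 0 ≤ G.S k) (hQS : ∀ k, 0 ≤ Q.S' k) (hμ : μ ∈ klWindowC)
    {Nf₁ Nf₂ : ℕ} (hOK₁ : FrameOK R U Nf₁ μ (klFlowFrameU L M β U μ m)) (hOK₂ : FrameOK R U Nf₂ μ (klFlowFrameU L M β U μ (m + 1)))
    {B₁ : ℝ} (hB0 : 0 ≤ B₁) (hB : ∀ y, |deriv salmhoferCutoff y| ≤ B₁)
    {fd : ℝ} (hfdist : frameDist (klFlowFrameU L M β U μ (m + 1)) (klFlowFrameU L M β U μ m) ≤ fd) (hfd : fd ≤ (klScale klE0 m) / 4)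
    (hZ₂ : IsUnit (effPartitionFn ℂ (normalCovariance L M (uvSymbolCT L M β μ (klFlowFrameU L M β U μ (m + 1)) (klScale klE0 m))) (hubbardInteraction L M β U + counterQuadratic L M β (klFlowFrameU L M β U μ (m + 1)))))
    (hZ : ∀ t ∈ Set.Icc (0 : ℝ) 1, effPartitionFn ℂ
      (normalCovariance L M (uvSymbolCT L M β μ (klFlowFrameU L M β U μ m) (klScale klE0 m)) + ((t : ℂ)) • (normalCovariance L M (fun ks => uvSymbolCT L M β μ (klFlowFrameU L M β U μ (m + 1)) (klScale klE0 m) ks / (1 + uvSymbolCT L M β μ (klFlowFrameU L M β U μ (m + 1)) (klScale klE0 m) ks * (((fsub (klFlowFrameU L M β U μ (m + 1)) (klFlowFrameU L M β U μ m)).eval (latticeMomentum L ks.1.2) / (β * (L : ℝ) ^ 2) : ℝ) : ℂ))) - normalCovariance L M (uvSymbolCT L M β μ (klFlowFrameU L M β U μ m) (klScale klE0 m)))) (hubbardInteraction L M β U + counterQuadratic L M β (klFlowFrameU L M β U μ m)) ≠ 0)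
    (j : ℕ) (q : Momentum) {N : ℝ} (hN0 : 0 ≤ N)
    (hN : ∀ t ∈ Set.Icc (0 : ℝ) 1, ∀ i ∈ ({omega0 M, (omega0 M).rev} : Finset (MatsubaraIdx M)), ∀ σ : Fin 2, ∀ Al : HubbardFieldIdx L M,
      |matsubaraFreq β M Al.1.1.1| < (klScale klE0 m) →
      (|nambuXiCT L μ (klFlowFrameU L M β U μ m) Al.1.1.2| < (klScale klE0 m) ∨ |nambuXiCT L μ (klFlowFrameU L M β U μ (m + 1)) Al.1.1.2| < (klScale klE0 m)) →
      ∑ x : TorusSite 2 L, (1 + ((x 0).valMinAbs.natAbs : ℝ) + ((x 1).valMinAbs.natAbs : ℝ)) ^ j * ‖torusFourierInv (fun kv : TorusSite 2 L =>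
        kernel ℂ (effAction ℂ (normalCovariance L M (uvSymbolCT L M β μ (klFlowFrameU L M β U μ m) (klScale klE0 m)) + ((t : ℂ)) • (normalCovariance L M (fun ks => uvSymbolCT L M β μ (klFlowFrameU L M β U μ (m + 1)) (klScale klE0 m) ks / (1 + uvSymbolCT L M β μ (klFlowFrameU L M β U μ (m + 1)) (klScale klE0 m) ks * (((fsub (klFlowFrameU L M β U μ (m + 1)) (klFlowFrameU L M β U μ m)).eval (latticeMomentum L ks.1.2) / (β * (L : ℝ) ^ 2) : ℝ) : ℂ))) - normalCovariance L M (uvSymbolCT L M β μ (klFlowFrameU L M β U μ m) (klScale klE0 m)))) (hubbardInteraction L M β U + counterQuadratic L M β (klFlowFrameU L M β U μ m))) 4 (Fin.snoc (Fin.snoc ![((((i, kv), σ), 0) : HubbardFieldIdx L M), (((i, kv), σ), 1)] (Al.1, 1 - Al.2) : Fin 3 → HubbardFieldIdx L M) Al)) x‖ ≤ N)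
    (hq₂ : (Real.pi / β) ^ 2 + frameLevel μ (klFlowFrameU L M β U μ (m + 1)) q ^ 2 < (klScale klE0 m) ^ 2 / 4) (hq₁ : (Real.pi / β) ^ 2 + frameLevel μ (klFlowFrameU L M β U μ m) q ^ 2 < (klScale klE0 m) ^ 2 / 4)
    {Md s : ℕ} (hM : 4 + j ≤ Md) {Sj Ss Sj' Ss' : ℝ}
    (hRmom : ∀ t ∈ Set.Icc (0 : ℝ) 1, ∀ i ∈ ({omega0 M, (omega0 M).rev} : Finset (MatsubaraIdx M)), ∀ σ : Fin 2,
      (∑ x : TorusSite 2 L, (1 + ((x 0).valMinAbs.natAbs : ℝ) + ((x 1).valMinAbs.natAbs : ℝ)) ^ j * ‖torusFourierInv (fun kv : TorusSite 2 L =>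
        kernel ℂ (effAction ℂ (normalCovariance L M (uvSymbolCT L M β μ (klFlowFrameU L M β U μ m) (klScale klE0 m)) + ((t : ℂ)) • (normalCovariance L M (fun ks => uvSymbolCT L M β μ (klFlowFrameU L M β U μ (m + 1)) (klScale klE0 m) ks / (1 + uvSymbolCT L M β μ (klFlowFrameU L M β U μ (m + 1)) (klScale klE0 m) ks * (((fsub (klFlowFrameU L M β U μ (m + 1)) (klFlowFrameU L M β U μ m)).eval (latticeMomentum L ks.1.2) / (β * (L : ℝ) ^ 2) : ℝ) : ℂ))) - normalCovariance L M (uvSymbolCT L M β μ (klFlowFrameU L M β U μ m) (klScale klE0 m)))) (hubbardInteraction L M β U + counterQuadratic L M β (klFlowFrameU L M β U μ m))) 2 ![((((i, kv), σ), 0) : HubbardFieldIdx L M), (((i, kv), σ), 1)]) x‖ ≤ Sj) ∧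
      (∑ x : TorusSite 2 L, (1 + ((x 0).valMinAbs.natAbs : ℝ) + ((x 1).valMinAbs.natAbs : ℝ)) ^ s * ‖torusFourierInv (fun kv : TorusSite 2 L =>
        kernel ℂ (effAction ℂ (normalCovariance L M (uvSymbolCT L M β μ (klFlowFrameU L M β U μ m) (klScale klE0 m)) + ((t : ℂ)) • (normalCovariance L M (fun ks => uvSymbolCT L M β μ (klFlowFrameU L M β U μ (m + 1)) (klScale klE0 m) ks / (1 + uvSymbolCT L M β μ (klFlowFrameU L M β U μ (m + 1)) (klScale klE0 m) ks * (((fsub (klFlowFrameU L M β U μ (m + 1)) (klFlowFrameU L M β U μ m)).eval (latticeMomentum L ks.1.2) / (β * (L : ℝ) ^ 2) : ℝ) : ℂ))) - normalCovariance L M (uvSymbolCT L M β μ (klFlowFrameU L M β U μ m) (klScale klE0 m)))) (hubbardInteraction L M β U + counterQuadratic L M β (klFlowFrameU L M β U μ m))) 2 ![((((i, kv), σ), 0) : HubbardFieldIdx L M), (((i, kv), σ), 1)]) x‖ ≤ Ss))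
    (hSE : ∀ i ∈ ({omega0 M, (omega0 M).rev} : Finset (MatsubaraIdx M)), ∀ σ : Fin 2,
      (∑ x : TorusSite 2 L, (1 + ((x 0).valMinAbs.natAbs : ℝ) + ((x 1).valMinAbs.natAbs : ℝ)) ^ j * ‖torusFourierInv (fun kv : TorusSite 2 L =>
        selfEnergy L M β (effAction ℂ (normalCovariance L M (fun ks => uvSymbolCT L M β μ (klFlowFrameU L M β U μ (m + 1)) (klScale klE0 m) ks / (1 + uvSymbolCT L M β μ (klFlowFrameU L M β U μ (m + 1)) (klScale klE0 m) ks * (((fsub (klFlowFrameU L M β U μ (m + 1)) (klFlowFrameU L M β U μ m)).eval (latticeMomentum L ks.1.2) / (β * (L : ℝ) ^ 2) : ℝ) : ℂ)))) (hubbardInteraction L M β U + counterQuadratic L M β (klFlowFrameU L M β U μ m))) (i, kv) σ) x‖ ≤ Sj') ∧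
      (∑ x : TorusSite 2 L, (1 + ((x 0).valMinAbs.natAbs : ℝ) + ((x 1).valMinAbs.natAbs : ℝ)) ^ s * ‖torusFourierInv (fun kv : TorusSite 2 L =>
        selfEnergy L M β (effAction ℂ (normalCovariance L M (fun ks => uvSymbolCT L M β μ (klFlowFrameU L M β U μ (m + 1)) (klScale klE0 m) ks / (1 + uvSymbolCT L M β μ (klFlowFrameU L M β U μ (m + 1)) (klScale klE0 m) ks * (((fsub (klFlowFrameU L M β U μ (m + 1)) (klFlowFrameU L M β U μ m)).eval (latticeMomentum L ks.1.2) / (β * (L : ℝ) ^ 2) : ℝ) : ℂ)))) (hubbardInteraction L M β U + counterQuadratic L M β (klFlowFrameU L M β U μ m))) (i, kv) σ) x‖ ≤ Ss'))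
    -- the Gevrey flow tables (`…EngineFrameShiftDressingFactorTablesG`)
    {X₄ : ℝ} (hX4 : ∀ l ≤ 4, ∀ x : ℝ, ‖iteratedFDeriv ℝ l salmhoferCutoff x‖ ≤ X₄)
    {X₀ Cχ : ℝ} (hX1 : 1 ≤ X₀) (hC : 0 ≤ Cχ) (hXG : ∀ l ≤ Md, ∀ x : ℝ, ‖iteratedFDeriv ℝ l salmhoferCutoff x‖ ≤ X₀ * ((l ! : ℝ)) ^ 2 * Cχ ^ l)
    {n : ℕ} (hP : ∀ m' ≤ n, FlowPieceJetsAt L M β U μ R m') (hTJ : ∀ m' ≤ n, TwoLegReadJetsF L M G Q β U μ m') (hmn : m ≤ n)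
    {Ξ Θ Φ : ℝ} (hΞ0 : 0 ≤ Ξ) (hΘ0 : 0 ≤ Θ) (hΦ0 : 0 ≤ Φ) (hΞ : ∀ i, 1 ≤ i → (if i ≤ 4 then R.Gfr i * uPow i U
      else 2 ^ i * (Real.pi ^ 8 / 4 * 2 ^ (i - 1) * (2 : ℝ) ^ (8 * (i - 1))) *
        ((curveExtC X₄ G.S 1 + curveExtC X₄ Q.S' 1 * |U|) * U ^ 2)) ≤ i ! * Ξ ^ i)
    (hΘΦ : ∀ i : ℕ, (if i ≤ 4 then R.Gfr i * uPow i U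
      else 2 ^ i * (Real.pi ^ 8 / 4 * 2 ^ (i - 1) * (2 : ℝ) ^ (8 * (i - 1))) *
        ((curveExtC X₄ G.S 1 + curveExtC X₄ Q.S' 1 * |U|) * U ^ 2)) ≤ R.Gfr 0 * |U| * Θ * i ! * (2 ^ 10 * Φ) ^ i)
    (hδΛ : (R.Gfr 0 * |U| * Θ * ((16 : ℝ) ^ m)⁻¹) ≤ (klScale klE0 m) / 4) :
    ‖iteratedFDeriv ℝ j (evalM (symInterp L (fun kv : TorusSite 2 L =>
        klLocSelfEnergyRe L M β U μ (klFlowFrameU L M β U μ (m + 1)) m kv - klLocSelfEnergyRe L M β U μ (klFlowFrameU L M β U μ m) m kv - (fsub (klFlowFrameU L M β U μ (m + 1)) (klFlowFrameU L M β U μ m)).eval (latticeMomentum L kv)))) q‖ ≤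
      2 * (2 * (|β| * (L : ℝ) ^ 2) * (12 * (2 * ((klScale klE0 m) * β / Real.pi + 3) *
        ((1793 * (klScale klE0 m) * (L : ℝ) ^ 2 + 704 * L) + (1793 * (klScale klE0 m) * (L : ℝ) ^ 2 + 704 * L)) *
        (β * (L : ℝ) ^ 2 * (200 + 200 * B₁) / (klScale klE0 m) ^ 2 * fd)) * N)) +
      (4 * (2 * (2 * ((2 * |β| * (L : ℝ) ^ 2 * Sj ^ 2) * ((3 : ℝ) ^ j * (X₀ * (|(β * (L : ℝ) ^ 2)| * (6 / (klScale klE0 m))) * ((Md ! : ℝ)) ^ 2 * (2 * (4 * (2 * (4 * (4 + (4 : ℝ) ^ m * Ξ) * (1 + 16 * (1 + Cχ) / (klScale klE0 m) * 1) + (2 ^ 10 * Φ * (4 : ℝ) ^ m))) * (1 + 6 / (klScale klE0 m) * ((klScale klE0 m) / 128 + X₀ * (R.Gfr 0 * |U| * Θ * ((16 : ℝ) ^ m)⁻¹))))) ^ Md +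
        X₀ * (|(β * (L : ℝ) ^ 2)| * (2 / (klScale klE0 m))) * ((Md ! : ℝ)) ^ 2 * (4 * ((4 + (4 : ℝ) ^ m * Ξ) + (2 ^ 10 * Φ * (4 : ℝ) ^ m)) * (1 + 2 * (16 * (1 + Cχ) / (klScale klE0 m)) * (1 + (R.Gfr 0 * |U| * Θ * ((16 : ℝ) ^ m)⁻¹)))) ^ Md) * (2 / ((2 * (L / 4 + 1) : ℕ) : ℝ)) ^ (Md - j - 4) * (2 ^ 2 * ∑' k : Fin 2 → ℤ, ∏ c, (1 + (k c : ℝ) ^ 2)⁻¹)))) + (L : ℝ) ^ 2 * (L : ℝ) ^ j * ((X₀ * (|(β * (L : ℝ) ^ 2)| * (6 / (klScale klE0 m))) * ((0 ! : ℝ)) ^ 2 * (2 * (4 * (2 * (4 * (4 + (4 : ℝ) ^ m * Ξ) * (1 + 16 * (1 + Cχ) / (klScale klE0 m) * 1) + (2 ^ 10 * Φ * (4 : ℝ) ^ m))) * (1 + 6 / (klScale klE0 m) * ((klScale klE0 m) / 128 + X₀ * (R.Gfr 0 * |U| * Θ * ((16 : ℝ) ^ m)⁻¹))))) ^ 0 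+
        X₀ * (|(β * (L : ℝ) ^ 2)| * (2 / (klScale klE0 m))) * ((0 ! : ℝ)) ^ 2 * (4 * ((4 + (4 : ℝ) ^ m * Ξ) + (2 ^ 10 * Φ * (4 : ℝ) ^ m)) * (1 + 2 * (16 * (1 + Cχ) / (klScale klE0 m)) * (1 + (R.Gfr 0 * |U| * Θ * ((16 : ℝ) ^ m)⁻¹)))) ^ 0) * ((2 * |β| * (L : ℝ) ^ 2 * Ss ^ 2) / (1 + (L : ℝ) / 4) ^ s)))) + (2 * (2 : ℕ) * ((2 * (2 * ((1 / 4 : ℝ) * ((3 : ℝ) ^ j * (((R.Gfr 0 * |U| * Θ * ((16 : ℝ) ^ m)⁻¹) * (R.Gfr 0 * |U| * Θ * ((16 : ℝ) ^ m)⁻¹) / |(β * (L : ℝ) ^ 2)|) * (X₀ * (|(β * (L : ℝ) ^ 2)| * (6 / (klScale klE0 m)))) * ((Md ! : ℝ)) ^ 2 * (2 * (2 * (2 ^ 10 * Φ * (4 : ℝ) ^ m) + 2 * (4 * (2 * (4 * (4 + (4 : ℝ) ^ m * Ξ) * (1 + 16 * (1 + Cχ) / (klScale klE0 m) * 1) +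 (2 ^ 10 * Φ * (4 : ℝ) ^ m))) * (1 + 6 / (klScale klE0 m) * ((klScale klE0 m) / 128 + X₀ * (R.Gfr 0 * |U| * Θ * ((16 : ℝ) ^ m)⁻¹)))))) ^ Md) * (2 / ((2 * (L / 4 + 1) : ℕ) : ℝ)) ^ (Md - j - 4) * (2 ^ 2 * ∑' k : Fin 2 → ℤ, ∏ c, (1 + (k c : ℝ) ^ 2)⁻¹)))) + (L : ℝ) ^ 2 * (L : ℝ) ^ j * ((((R.Gfr 0 * |U| * Θ * ((16 : ℝ) ^ m)⁻¹) * (R.Gfr 0 * |U| * Θ * ((16 : ℝ) ^ m)⁻¹) / |(β * (L : ℝ) ^ 2)|) * (X₀ * (|(β * (L : ℝ) ^ 2)| * (6 / (klScale klE0 m)))) * ((0 ! : ℝ)) ^ 2 * (2 * (2 * (2 ^ 10 * Φ * (4 : ℝ) ^ m) + 2 * (4 * (2 * (4 * (4 + (4 : ℝ) ^ m * Ξ) * (1 + 16 * (1 + Cχ) / (klScale klE0 m) * 1) + (2 ^ 10 * Φ * (4 : ℝ) ^ m))) * (1 + 6 / (klScale klE0 m) * ((klScale klE0 m) / 128 +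 X₀ * (R.Gfr 0 * |U| * Θ * ((16 : ℝ) ^ m)⁻¹)))))) ^ 0) * ((1 / 4 : ℝ) / (1 + (L : ℝ) / 4) ^ s))) + (2 * (2 * ((1 / 4 * Sj') * ((3 : ℝ) ^ j * (((R.Gfr 0 * |U| * Θ * ((16 : ℝ) ^ m)⁻¹) / |(β * (L : ℝ) ^ 2)| * (X₀ * (|(β * (L : ℝ) ^ 2)| * (6 / (klScale klE0 m))))) * ((R.Gfr 0 * |U| * Θ * ((16 : ℝ) ^ m)⁻¹) / |(β * (L : ℝ) ^ 2)| * (X₀ * (|(β * (L : ℝ) ^ 2)| * (6 / (klScale klE0 m))))) * ((Md ! : ℝ)) ^ 2 * (2 * (2 * (2 * (2 ^ 10 * Φ * (4 : ℝ) ^ m) + 2 * (4 * (2 * (4 * (4 + (4 : ℝ) ^ m * Ξ) * (1 + 16 * (1 + Cχ) / (klScale klE0 m) * 1) + (2 ^ 10 * Φ * (4 : ℝ) ^ m))) * (1 + 6 / (klScale klE0 m) * ((klScale klE0 m) / 128 + X₀ * (R.Gfr 0 * |U| * Θ * ((16 : ℝ) ^ m)⁻¹))))))) ^ Md + 2 *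 (((R.Gfr 0 * |U| * Θ * ((16 : ℝ) ^ m)⁻¹) / |(β * (L : ℝ) ^ 2)|) * (X₀ * (|(β * (L : ℝ) ^ 2)| * (6 / (klScale klE0 m)))) * ((Md ! : ℝ)) ^ 2 * (2 * (2 * (2 ^ 10 * Φ * (4 : ℝ) ^ m) + 2 * (4 * (2 * (4 * (4 + (4 : ℝ) ^ m * Ξ) * (1 + 16 * (1 + Cχ) / (klScale klE0 m) * 1) + (2 ^ 10 * Φ * (4 : ℝ) ^ m))) * (1 + 6 / (klScale klE0 m) * ((klScale klE0 m) / 128 + X₀ * (R.Gfr 0 * |U| * Θ * ((16 : ℝ) ^ m)⁻¹)))))) ^ Md)) * (2 / ((2 * (L / 4 + 1) : ℕ) : ℝ)) ^ (Md - j - 4) * (2 ^ 2 * ∑' k : Fin 2 → ℤ, ∏ c, (1 + (k c : ℝ) ^ 2)⁻¹)))) + (L : ℝ) ^ 2 * (L : ℝ) ^ j * ((((R.Gfr 0 * |U| * Θ * ((16 : ℝ) ^ m)⁻¹) / |(β * (L : ℝ) ^ 2)| * (X₀ * (|(β * (L : ℝ) ^ 2)| * (6 / (klScale klE0 m)))))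 * ((R.Gfr 0 * |U| * Θ * ((16 : ℝ) ^ m)⁻¹) / |(β * (L : ℝ) ^ 2)| * (X₀ * (|(β * (L : ℝ) ^ 2)| * (6 / (klScale klE0 m))))) * ((0 ! : ℝ)) ^ 2 * (2 * (2 * (2 * (2 ^ 10 * Φ * (4 : ℝ) ^ m) + 2 * (4 * (2 * (4 * (4 + (4 : ℝ) ^ m * Ξ) * (1 + 16 * (1 + Cχ) / (klScale klE0 m) * 1) + (2 ^ 10 * Φ * (4 : ℝ) ^ m))) * (1 + 6 / (klScale klE0 m) * ((klScale klE0 m) / 128 + X₀ * (R.Gfr 0 * |U| * Θ * ((16 : ℝ) ^ m)⁻¹))))))) ^ 0 + 2 * (((R.Gfr 0 * |U| * Θ * ((16 : ℝ) ^ m)⁻¹) / |(β * (L : ℝ) ^ 2)|) * (X₀ * (|(β * (L : ℝ) ^ 2)| * (6 / (klScale klE0 m)))) * ((0 ! : ℝ)) ^ 2 * (2 * (2 * (2 ^ 10 * Φ * (4 : ℝ) ^ m) + 2 * (4 * (2 * (4 * (4 + (4 : ℝ) ^ m * Ξ) * (1 + 16 * (1 + Cχ) / (klScale klE0 m) * 1)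 + (2 ^ 10 * Φ * (4 : ℝ) ^ m))) * (1 + 6 / (klScale klE0 m) * ((klScale klE0 m) / 128 + X₀ * (R.Gfr 0 * |U| * Θ * ((16 : ℝ) ^ m)⁻¹)))))) ^ 0)) * ((1 / 4 * Ss') / (1 + (L : ℝ) / 4) ^ s))))) := by
  have hω : ∀ i : MatsubaraIdx M, matsubaraFreq β M i ≠ 0 := fun i => matsubaraFreq_ne_zero hβ.ne' i
  have hdD : ∀ i ∈ ({omega0 M, (omega0 M).rev} : Finset (MatsubaraIdx M)), ∀ q' : Momentum, ‖iteratedFDeriv ℝ Md (fun q : Momentum => ((((uvWeightFn (klScale klE0 m) (matsubaraFreq β M i) (frameLevel μ (klFlowFrameU L M β U μ (m + 1)) q) : ℝ) : ℂ) * resolventFnXi (β * (L : ℝ) ^ 2) 0 (matsubaraFreq β M i) (frameLevel μ (klFlowFrameU L M β U μ (m + 1)) q + uvWeightFn (klScale klE0 m) (matsubaraFreq β M i) (frameLevel μ (klFlowFrameU L M β U μ (m + 1)) q) * evalM (fsub (klFlowFrameU L M β U μ (m + 1)) (klFlowFrameU L M β U μ m)) q)) - uvSymbolFnXi (β * (L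 : ℝ) ^ 2) (klScale klE0 m) (matsubaraFreq β M i) (frameLevel μ (klFlowFrameU L M β U μ (m + 1)) q + evalM (fsub (klFlowFrameU L M β U μ (m + 1)) (klFlowFrameU L M β U μ m)) q))) q'‖ ≤ X₀ * (|(β * (L : ℝ) ^ 2)| * (6 / (klScale klE0 m))) * ((Md ! : ℝ)) ^ 2 * (2 * (4 * (2 * (4 * (4 + (4 : ℝ) ^ m * Ξ) * (1 + 16 * (1 + Cχ) / (klScale klE0 m) * 1) + (2 ^ 10 * Φ * (4 : ℝ) ^ m))) * (1 + 6 / (klScale klE0 m) * ((klScale klE0 m) / 128 + X₀ * (R.Gfr 0 * |U| * Θ * ((16 : ℝ) ^ m)⁻¹))))) ^ Md +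
        X₀ * (|(β * (L : ℝ) ^ 2)| * (2 / (klScale klE0 m))) * ((Md ! : ℝ)) ^ 2 * (4 * ((4 + (4 : ℝ) ^ m * Ξ) + (2 ^ 10 * Φ * (4 : ℝ) ^ m)) * (1 + 2 * (16 * (1 + Cχ) / (klScale klE0 m)) * (1 + (R.Gfr 0 * |U| * Θ * ((16 : ℝ) ^ m)⁻¹)))) ^ Md :=
    fun i _ q' => norm_iteratedFDeriv_defect_flowFrame_le_gevrey (hR := hRG) (hGS := hGS) (hQS := hQS) (hμ := hμ) (hX4 := hX4) (hX1 := hX1) (hC := hC) (hXG := hXG) (hP := hP) (hT := hTJ) (hmn := hmn) (hΞ0 := hΞ0) (hΘ0 := hΘ0) (hΦ0 := hΦ0) (hΞ := hΞ) (hΘΦ := hΘΦ) (hδΛ := hδΛ) (hω := hω i) (c := (β * (L : ℝ) ^ 2)) le_rfl q'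
  have hdA : ∀ i ∈ ({omega0 M, (omega0 M).rev} : Finset (MatsubaraIdx M)), ∀ q' : Momentum, ‖(fun q : Momentum => ((((uvWeightFn (klScale klE0 m) (matsubaraFreq β M i) (frameLevel μ (klFlowFrameU L M β U μ (m + 1)) q) : ℝ) : ℂ) * resolventFnXi (β * (L : ℝ) ^ 2) 0 (matsubaraFreq β M i) (frameLevel μ (klFlowFrameU L M β U μ (m + 1)) q + uvWeightFn (klScale klE0 m) (matsubaraFreq β M i) (frameLevel μ (klFlowFrameU L M β U μ (m + 1)) q) * evalM (fsub (klFlowFrameU L M β U μ (m + 1)) (klFlowFrameU L M β U μ m)) q)) - uvSymbolFnXi (β * (L : ℝ) ^ 2) (klScale klE0 m) (matsubaraFreq β M i) (frameLevel μ (klFlowFrameU L M β U μ (m + 1)) q + evalM (fsub (klFlowFrameU L M β U μ (m + 1)) (klFlowFrameU L M β U μ m)) q))) q'‖ ≤ X₀ * (|(β * (L : ℝ) ^ 2)| * (6 / (klScale klE0 m))) * ((0 ! : ℝ)) ^ 2 * (2 * (4 * (2 * (4 * (4 + (4 : ℝ) ^ m * Ξ) * (1 + 16 * (1 + Cχ)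 / (klScale klE0 m) * 1) + (2 ^ 10 * Φ * (4 : ℝ) ^ m))) * (1 + 6 / (klScale klE0 m) * ((klScale klE0 m) / 128 + X₀ * (R.Gfr 0 * |U| * Θ * ((16 : ℝ) ^ m)⁻¹))))) ^ 0 +
        X₀ * (|(β * (L : ℝ) ^ 2)| * (2 / (klScale klE0 m))) * ((0 ! : ℝ)) ^ 2 * (4 * ((4 + (4 : ℝ) ^ m * Ξ) + (2 ^ 10 * Φ * (4 : ℝ) ^ m)) * (1 + 2 * (16 * (1 + Cχ) / (klScale klE0 m)) * (1 + (R.Gfr 0 * |U| * Θ * ((16 : ℝ) ^ m)⁻¹)))) ^ 0 := by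
    intro i _ q'
    have h := norm_iteratedFDeriv_defect_flowFrame_le_gevrey (hR := hRG) (hGS := hGS) (hQS := hQS) (hμ := hμ) (hX4 := hX4) (hX1 := hX1) (hC := hC) (hXG := hXG) (hP := hP) (hT := hTJ) (hmn := hmn) (hΞ0 := hΞ0) (hΘ0 := hΘ0) (hΦ0 := hΦ0) (hΞ := hΞ) (hΘΦ := hΘΦ) (hδΛ := hδΛ) (hω := hω i) (c := (β * (L : ℝ) ^ 2)) (Nat.zero_le Md) q'
    rw [norm_iteratedFDeriv_zero] at h
    exact h
  have haD : ∀ i ∈ ({omega0 M, (omega0 M).rev} : Finset (MatsubaraIdx M)), ∀ q' : Momentum, ‖iteratedFDeriv ℝ Md (fun q : Momentum => (-((((evalM (fsub (klFlowFrameU L M β U μ (m + 1)) (klFlowFrameU L M β U μ m)) q * evalM (fsub (klFlowFrameU L M β U μ (m + 1)) (klFlowFrameU L M β U μ m)) q) / (β * (L : ℝ) ^ 2) : ℝ)) : ℂ) * (((uvWeightFn (klScale klE0 m) (matsubaraFreq β M i) (frameLevel μ (klFlowFrameU L M β U μ (m + 1)) q) : ℝ) : ℂ) * resolventFnXi (β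 * (L : ℝ) ^ 2) 0 (matsubaraFreq β M i) (frameLevel μ (klFlowFrameU L M β U μ (m + 1)) q + uvWeightFn (klScale klE0 m) (matsubaraFreq β M i) (frameLevel μ (klFlowFrameU L M β U μ (m + 1)) q) * evalM (fsub (klFlowFrameU L M β U μ (m + 1)) (klFlowFrameU L M β U μ m)) q)))) q'‖ ≤ ((R.Gfr 0 * |U| * Θ * ((16 : ℝ) ^ m)⁻¹) * (R.Gfr 0 * |U| * Θ * ((16 : ℝ) ^ m)⁻¹) / |(β * (L : ℝ) ^ 2)|) * (X₀ * (|(β * (L : ℝ) ^ 2)| * (6 / (klScale klE0 m)))) * ((Md ! : ℝ)) ^ 2 * (2 * (2 * (2 ^ 10 * Φ * (4 : ℝ) ^ m) + 2 * (4 * (2 * (4 * (4 + (4 : ℝ) ^ m * Ξ) * (1 + 16 * (1 + Cχ) / (klScale klE0 m) * 1) + (2 ^ 10 * Φ * (4 : ℝ) ^ m))) * (1 + 6 / (klScale klE0 m) * ((klScale klE0 m) / 128 + X₀ * (R.Gfr 0 * |U| * Θ * ((16 : ℝ) ^ m)⁻¹)))))) ^ Md :=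
    fun i _ q' => norm_iteratedFDeriv_J₂_flowFrame_le_gevrey (hR := hRG) (hGS := hGS) (hQS := hQS) (hμ := hμ) (hX4 := hX4) (hX1 := hX1) (hC := hC) (hXG := hXG) (hP := hP) (hT := hTJ) (hmn := hmn) (hΞ0 := hΞ0) (hΘ0 := hΘ0) (hΦ0 := hΦ0) (hΞ := hΞ) (hΘΦ := hΘΦ) (hδΛ := hδΛ) (hω := hω i) (c := (β * (L : ℝ) ^ 2)) le_rfl q'
  have haA : ∀ i ∈ ({omega0 M, (omega0 M).rev} : Finset (MatsubaraIdx M)), ∀ q' : Momentum, ‖(fun q : Momentum => (-((((evalM (fsub (klFlowFrameU L M β U μ (m + 1)) (klFlowFrameU L M β U μ m)) q * evalM (fsub (klFlowFrameU L M β U μ (m + 1)) (klFlowFrameU L M β U μ m)) q) / (β * (L : ℝ) ^ 2) : ℝ)) : ℂ) * (((uvWeightFn (klScale klE0 m) (matsubaraFreq β M i) (frameLevel μ (klFlowFrameU L M β U μ (m + 1)) q) : ℝ) : ℂ) * resolventFnXi (β * (L : ℝ) ^ 2) 0 (matsubaraFreq β M i) (frameLevel μ (klFlowFrameU L M β U μ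 (m + 1)) q + uvWeightFn (klScale klE0 m) (matsubaraFreq β M i) (frameLevel μ (klFlowFrameU L M β U μ (m + 1)) q) * evalM (fsub (klFlowFrameU L M β U μ (m + 1)) (klFlowFrameU L M β U μ m)) q)))) q'‖ ≤ ((R.Gfr 0 * |U| * Θ * ((16 : ℝ) ^ m)⁻¹) * (R.Gfr 0 * |U| * Θ * ((16 : ℝ) ^ m)⁻¹) / |(β * (L : ℝ) ^ 2)|) * (X₀ * (|(β * (L : ℝ) ^ 2)| * (6 / (klScale klE0 m)))) * ((0 ! : ℝ)) ^ 2 * (2 * (2 * (2 ^ 10 * Φ * (4 : ℝ) ^ m) + 2 * (4 * (2 * (4 * (4 + (4 : ℝ) ^ m * Ξ) * (1 + 16 * (1 + Cχ) / (klScale klE0 m) * 1) + (2 ^ 10 * Φ * (4 : ℝ) ^ m))) * (1 + 6 / (klScale klE0 m) * ((klScale klE0 m) / 128 + X₀ * (R.Gfr 0 * |U| * Θ * ((16 : ℝ) ^ m)⁻¹)))))) ^ 0 := by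
    intro i _ q'
    have h := norm_iteratedFDeriv_J₂_flowFrame_le_gevrey (hR := hRG) (hGS := hGS) (hQS := hQS) (hμ := hμ) (hX4 := hX4) (hX1 := hX1) (hC := hC) (hXG := hXG) (hP := hP) (hT := hTJ) (hmn := hmn) (hΞ0 := hΞ0) (hΘ0 := hΘ0) (hΦ0 := hΦ0) (hΞ := hΞ) (hΘΦ := hΘΦ) (hδΛ := hδΛ) (hω := hω i) (c := (β * (L : ℝ) ^ 2)) (Nat.zero_le Md) q'
    rw [norm_iteratedFDeriv_zero] at h
    exact h
  have hbD : ∀ i ∈ ({omega0 M, (omega0 M).rev} : Finset (MatsubaraIdx M)), ∀ q' : Momentum, ‖iteratedFDeriv ℝ Md (fun q : Momentum => (((((evalM (fsub (klFlowFrameU L M β U μ (m + 1)) (klFlowFrameU L M β U μ m)) q / (β * (L : ℝ) ^ 2) : ℝ)) : ℂ) * (((uvWeightFn (klScale klE0 m) (matsubaraFreq β M i) (frameLevel μ (klFlowFrameU L M β U μ (m + 1)) q) : ℝ) : ℂ) * resolventFnXi (β * (L : ℝ) ^ 2) 0 (matsubaraFreq β M i) (frameLevel μ (klFlowFrameU L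 M β U μ (m + 1)) q + uvWeightFn (klScale klE0 m) (matsubaraFreq β M i) (frameLevel μ (klFlowFrameU L M β U μ (m + 1)) q) * evalM (fsub (klFlowFrameU L M β U μ (m + 1)) (klFlowFrameU L M β U μ m)) q))) * ((((evalM (fsub (klFlowFrameU L M β U μ (m + 1)) (klFlowFrameU L M β U μ m)) q / (β * (L : ℝ) ^ 2) : ℝ)) : ℂ) * (((uvWeightFn (klScale klE0 m) (matsubaraFreq β M i) (frameLevel μ (klFlowFrameU L M β U μ (m + 1)) q) : ℝ) : ℂ) * resolventFnXi (β * (L : ℝ) ^ 2) 0 (matsubaraFreq β M i) (frameLevel μ (klFlowFrameU L M β U μ (m + 1)) q + uvWeightFn (klScale klE0 m) (matsubaraFreq β M i) (frameLevel μ (klFlowFrameU L M β U μ (m + 1)) q) * evalM (fsub (klFlowFrameU L M β U μ (m + 1)) (klFlowFrameU L M β U μ m)) q))) - (2 : ℂ) * ((((evalM (fsub (klFlowFrameU L M β U μ (m + 1)) (klFlowFrameU L M β U μ m)) q / (β * (L : ℝ) ^ 2) : ℝ)) : ℂ) * (((uvWeightFn (klScale klE0 m) (matsubaraFreq β M i)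 (frameLevel μ (klFlowFrameU L M β U μ (m + 1)) q) : ℝ) : ℂ) * resolventFnXi (β * (L : ℝ) ^ 2) 0 (matsubaraFreq β M i) (frameLevel μ (klFlowFrameU L M β U μ (m + 1)) q + uvWeightFn (klScale klE0 m) (matsubaraFreq β M i) (frameLevel μ (klFlowFrameU L M β U μ (m + 1)) q) * evalM (fsub (klFlowFrameU L M β U μ (m + 1)) (klFlowFrameU L M β U μ m)) q))))) q'‖ ≤ ((R.Gfr 0 * |U| * Θ * ((16 : ℝ) ^ m)⁻¹) / |(β * (L : ℝ) ^ 2)| * (X₀ * (|(β * (L : ℝ) ^ 2)| * (6 / (klScale klE0 m))))) * ((R.Gfr 0 * |U| * Θ * ((16 : ℝ) ^ m)⁻¹) / |(β * (L : ℝ) ^ 2)| * (X₀ * (|(β * (L : ℝ) ^ 2)| * (6 / (klScale klE0 m))))) * ((Md ! : ℝ)) ^ 2 * (2 * (2 * (2 * (2 ^ 10 * Φ * (4 : ℝ) ^ m) + 2 * (4 * (2 * (4 * (4 + (4 : ℝ) ^ m * Ξ) * (1 + 16 * (1 + Cχ) / (klScale klE0 m) * 1) + (2 ^ 10 * Φ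 * (4 : ℝ) ^ m))) * (1 + 6 / (klScale klE0 m) * ((klScale klE0 m) / 128 + X₀ * (R.Gfr 0 * |U| * Θ * ((16 : ℝ) ^ m)⁻¹))))))) ^ Md + 2 * (((R.Gfr 0 * |U| * Θ * ((16 : ℝ) ^ m)⁻¹) / |(β * (L : ℝ) ^ 2)|) * (X₀ * (|(β * (L : ℝ) ^ 2)| * (6 / (klScale klE0 m)))) * ((Md ! : ℝ)) ^ 2 * (2 * (2 * (2 ^ 10 * Φ * (4 : ℝ) ^ m) + 2 * (4 * (2 * (4 * (4 + (4 : ℝ) ^ m * Ξ) * (1 + 16 * (1 + Cχ) / (klScale klE0 m) * 1) + (2 ^ 10 * Φ * (4 : ℝ) ^ m))) * (1 + 6 / (klScale klE0 m) * ((klScale klE0 m) / 128 + X₀ * (R.Gfr 0 * |U| * Θ * ((16 : ℝ) ^ m)⁻¹)))))) ^ Md) :=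
    fun i _ q' => norm_iteratedFDeriv_J₁_flowFrame_le_gevrey (hR := hRG) (hGS := hGS) (hQS := hQS) (hμ := hμ) (hX4 := hX4) (hX1 := hX1) (hC := hC) (hXG := hXG) (hP := hP) (hT := hTJ) (hmn := hmn) (hΞ0 := hΞ0) (hΘ0 := hΘ0) (hΦ0 := hΦ0) (hΞ := hΞ) (hΘΦ := hΘΦ) (hδΛ := hδΛ) (hω := hω i) (c := (β * (L : ℝ) ^ 2)) le_rfl q'
  have hbA : ∀ i ∈ ({omega0 M, (omega0 M).rev} : Finset (MatsubaraIdx M)), ∀ q' : Momentum, ‖(fun q : Momentum => (((((evalM (fsub (klFlowFrameU L M β U μ (m + 1)) (klFlowFrameU L M β U μ m)) q / (β * (L : ℝ) ^ 2) : ℝ)) : ℂ) * (((uvWeightFn (klScale klE0 m) (matsubaraFreq β M i) (frameLevel μ (klFlowFrameU L M β U μ (m + 1)) q) : ℝ) : ℂ) * resolventFnXi (β * (L : ℝ) ^ 2) 0 (matsubaraFreq β M i) (frameLevel μ (klFlowFrameU L M β U μ (m + 1)) q + uvWeightFn (klScale klE0 m) (matsubaraFreq β M i) (frameLevel μ (klFlowFrameU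 L M β U μ (m + 1)) q) * evalM (fsub (klFlowFrameU L M β U μ (m + 1)) (klFlowFrameU L M β U μ m)) q))) * ((((evalM (fsub (klFlowFrameU L M β U μ (m + 1)) (klFlowFrameU L M β U μ m)) q / (β * (L : ℝ) ^ 2) : ℝ)) : ℂ) * (((uvWeightFn (klScale klE0 m) (matsubaraFreq β M i) (frameLevel μ (klFlowFrameU L M β U μ (m + 1)) q) : ℝ) : ℂ) * resolventFnXi (β * (L : ℝ) ^ 2) 0 (matsubaraFreq β M i) (frameLevel μ (klFlowFrameU L M β U μ (m + 1)) q + uvWeightFn (klScale klE0 m) (matsubaraFreq β M i) (frameLevel μ (klFlowFrameU L M β U μ (m + 1)) q) * evalM (fsub (klFlowFrameU L M β U μ (m + 1)) (klFlowFrameU L M β U μ m)) q))) - (2 : ℂ) * ((((evalM (fsub (klFlowFrameU L M β U μ (m + 1)) (klFlowFrameU L M β U μ m)) q / (β * (L : ℝ) ^ 2) : ℝ)) : ℂ) * (((uvWeightFn (klScale klE0 m) (matsubaraFreq β M i) (frameLevel μ (klFlowFrameU L M β U μ (m + 1)) q) : ℝ) : ℂ) * resolventFnXi (β * (L : ℝ)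 ^ 2) 0 (matsubaraFreq β M i) (frameLevel μ (klFlowFrameU L M β U μ (m + 1)) q + uvWeightFn (klScale klE0 m) (matsubaraFreq β M i) (frameLevel μ (klFlowFrameU L M β U μ (m + 1)) q) * evalM (fsub (klFlowFrameU L M β U μ (m + 1)) (klFlowFrameU L M β U μ m)) q))))) q'‖ ≤ ((R.Gfr 0 * |U| * Θ * ((16 : ℝ) ^ m)⁻¹) / |(β * (L : ℝ) ^ 2)| * (X₀ * (|(β * (L : ℝ) ^ 2)| * (6 / (klScale klE0 m))))) * ((R.Gfr 0 * |U| * Θ * ((16 : ℝ) ^ m)⁻¹) / |(β * (L : ℝ) ^ 2)| * (X₀ * (|(β * (L : ℝ) ^ 2)| * (6 / (klScale klE0 m))))) * ((0 ! : ℝ)) ^ 2 * (2 * (2 * (2 * (2 ^ 10 * Φ * (4 : ℝ) ^ m) + 2 * (4 * (2 * (4 * (4 + (4 : ℝ) ^ m * Ξ) * (1 + 16 * (1 + Cχ) / (klScale klE0 m) * 1) + (2 ^ 10 * Φ * (4 : ℝ) ^ m))) * (1 + 6 / (klScale klE0 m) * ((klScale klE0 m) / 128 + X₀ * (R.Gfr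 0 * |U| * Θ * ((16 : ℝ) ^ m)⁻¹))))))) ^ 0 + 2 * (((R.Gfr 0 * |U| * Θ * ((16 : ℝ) ^ m)⁻¹) / |(β * (L : ℝ) ^ 2)|) * (X₀ * (|(β * (L : ℝ) ^ 2)| * (6 / (klScale klE0 m)))) * ((0 ! : ℝ)) ^ 2 * (2 * (2 * (2 ^ 10 * Φ * (4 : ℝ) ^ m) + 2 * (4 * (2 * (4 * (4 + (4 : ℝ) ^ m * Ξ) * (1 + 16 * (1 + Cχ) / (klScale klE0 m) * 1) + (2 ^ 10 * Φ * (4 : ℝ) ^ m))) * (1 + 6 / (klScale klE0 m) * ((klScale klE0 m) / 128 + X₀ * (R.Gfr 0 * |U| * Θ * ((16 : ℝ) ^ m)⁻¹)))))) ^ 0) := by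
    intro i _ q'
    have h := norm_iteratedFDeriv_J₁_flowFrame_le_gevrey (hR := hRG) (hGS := hGS) (hQS := hQS) (hμ := hμ) (hX4 := hX4) (hX1 := hX1) (hC := hC) (hXG := hXG) (hP := hP) (hT := hTJ) (hmn := hmn) (hΞ0 := hΞ0) (hΘ0 := hΘ0) (hΦ0 := hΦ0) (hΞ := hΞ) (hΘΦ := hΘΦ) (hδΛ := hδΛ) (hω := hω i) (c := (β * (L : ℝ) ^ 2)) (Nat.zero_le Md) q'
    rw [norm_iteratedFDeriv_zero] at h
    exact h
  have h := norm_iteratedFDeriv_klLocSelfEnergyRe_flowFrame_sub_le_aliasing hβ U μ m hOK₁ hOK₂ hB0 hB hfdist hfd hZ₂ hZ j q hN0 hN hq₂ hq₁ hM hRmom hSE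
    hdD hdA haD haA hbD hbA
  rw [add_self_div_two] at h
  exact h

end Flow

end Summit.HubbardSuperconductivity.HubbardSuperconductivity.Theorems.EngineV8

end
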